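import Literature.ModelTheory.ExponentialFields.SemialgebraicAngleTower
import HarnessLib

/-!
# Differentiability at vertex points of a generalized angle

Topic `Literature/ModelTheory/ExponentialFields` — block B4₅ of the proof of the
`C¹`-triangulation theorem for compact semialgebraic sets
(`Literature.ModelTheory.ExponentialFields.OhmotoShiota2017_c1Triangulation`, statement of
[OhmotoShiota2017, Thm. 1.1]) along the proof of [Pawlucki2024], specialized to `p = 1`.

The last step of the proof of [Pawlucki2024, Lemma 5.4] for `p = 1` ("it suffices to check that
all the partial derivatives have continuous extensions", via local quasi-convexity, [20, p. 80]) in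
the form needed here: if the `y`-partials of `f` have limits `G_i` at the vertex point `(a, 0)`
then `|f(u, y) - g(u) - Σ G_i y_i| ≤ ε ‖y‖` near `(a, 0)` (`vertex_deriv`, by descending the tower
as in block B4₄: vertical mean value steps with the derivative minus `G`, restriction to bottom
graphs, linearization of the bottom function), whence the extension of `f` by its spine limit `g`
is differentiable within the angle at `(a, 0)` with derivative `(Dg(a), G)` whenever `g` is
differentiable at `a` (`hasFDerivWithinAt_vertex`).  Only retraction towards the spine is used, no
quasi-convexity.

No named facts are introduced (D-0026).

## References

* [Pawlucki2024] W. Pawłucki, *Strict `C^p`-triangulations — a new approach to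
  desingularization*, J. Eur. Math. Soc. 26 (2024), 3863–3909, Lemma 5.4 and its proof (p = 1).
* [OhmotoShiota2017] T. Ohmoto, M. Shiota, *`C¹`-triangulations of semialgebraic sets*,
  J. Topology 10 (2017), Thm. 1.1 (statement only).
-/

noncomputable section

open Set Filter Metric
open _root_.Topology

namespace Literature.ModelTheory.ExponentialFields

section AngleDeriv

variable {k : ℕ}

/-- The punctured angle (off the spine). [cite: Pawlucki2024, Lemma 5.4] -/
def pAngle (Ω : Set (Fin k → ℝ)) (j : ℕ) (T : Tower k j) : Set (Fin (k + j) → ℝ) :=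
  {z | z ∈ angle Ω j T ∧ ypart j z ≠ 0}

/-- **Convergence of the `y`-partials at the vertex point.** [cite: Pawlucki2024, Lemma 5.4, (5.4.1)] -/
def DerivHyp (Ω : Set (Fin k → ℝ)) (j : ℕ) (T : Tower k j) (a : Fin k → ℝ) (f : (Fin (k + j) → ℝ) → ℝ) (Gv : Fin j → ℝ) : Prop :=
  ∀ i : Fin j, Tendsto (fun z => fderiv ℝ f z (Pi.single (Fin.natAdd k i) 1)) (𝓝[pAngle Ω j T] (spinePt j a)) (𝓝 (Gv i))

/-- **The first-order vertex estimate** `|f(u, y) - g(u) - Σ G_i y_i| ≤ ε ‖y‖`. [cite: Pawlucki2024, Lemma 5.4 (proof)] -/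
def VertexDerivEst (Ω : Set (Fin k → ℝ)) (j : ℕ) (T : Tower k j) (a : Fin k → ℝ) (f : (Fin (k + j) → ℝ) → ℝ) (Gv : Fin j → ℝ) : Prop :=
  ∀ ε : ℝ, 0 < ε → ∃ δ : ℝ, 0 < δ ∧ ∀ z ∈ angle Ω j T, dist z (spinePt j a) < δ → ypart j z ≠ 0 →
    |f z - spineLim j T f (upart j z) - ∑ i, Gv i * ypart j z i| ≤ ε * ‖ypart j z‖

/-! ### Level `1` -/

/-- **Base of the first-order estimate (level `1`).** [cite: Pawlucki2024, Lemma 5.4 (proof)] -/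
theorem vertex_deriv_one {Ω : Set (Fin k → ℝ)} (hΩ : IsOpen Ω) (T : Tower k 0) (ℓ : Level (k + 0))
    (H : Tower.Hyp Ω 1 ⟨T, ℓ⟩) {a : Fin k → ℝ} (ha : a ∈ Ω) {f : (Fin (k + 1) → ℝ) → ℝ} {Gv : Fin 1 → ℝ}
    {R M : ℝ} (hR : 0 < R) (hf : GradHyp Ω 1 ⟨T, ℓ⟩ a R M f) (hD : DerivHyp Ω 1 ⟨T, ℓ⟩ a f Gv) :
    VertexDerivEst Ω 1 ⟨T, ℓ⟩ a f Gv := by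
  obtain ⟨R', hR', hbase⟩ := vertex_estimate_one hΩ T ℓ H ha hR
  obtain ⟨hlim, -⟩ := hbase M f hf
  obtain ⟨-, -, -, hpinch, -⟩ := H
  obtain ⟨U, hUo, hsub, hd, -⟩ := hf
  intro ε hε
  -- `|∂_t f - G₀| < ε` near the vertex point
  have hD0 := Metric.tendsto_nhds.1 (hD 0) ε hε
  obtain ⟨O, hO, hOsub⟩ := eventually_iff_exists_mem.1 hD0
  obtain ⟨δ₁, hδ₁, hball⟩ : ∃ δ₁ > 0, ∀ z ∈ pAngle Ω 1 ⟨T, ℓ⟩, dist z (spinePt 1 a) < δ₁ → z ∈ O := by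
    obtain ⟨O', hO', hO'sub⟩ := mem_nhdsWithin_iff_exists_mem_nhds_inter.1 hO
    obtain ⟨δ₁, hδ₁, hb⟩ := Metric.mem_nhds_iff.1 hO'
    exact ⟨δ₁, hδ₁, fun z hz hdz => hO'sub ⟨hb hdz, hz⟩⟩
  set δ := min δ₁ (min R' R) with hδ
  have hδpos : 0 < δ := lt_min hδ₁ (lt_min hR' hR)
  refine ⟨δ, hδpos, fun z hz hdz hyz => ?_⟩
  have hlast : Fin.last (k + 0) = Fin.natAdd k (0 : Fin 1) := Fin.ext rfl
  -- `z = snoc u t`, `t > 0`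
  set u : Fin (k + 0) → ℝ := Fin.init z with hu
  set t := z (Fin.last (k + 0)) with ht
  have hzw : (Fin.snoc u t : Fin (k + 0 + 1) → ℝ) = z := Fin.snoc_init_self z
  have huA : u ∈ angle Ω 0 T := hz.1
  have hφ0 : ℓ.φ u = 0 := (hpinch u huA (ypart_zero u)).1
  have htpos : 0 < t := by
    have h0 : ℓ.φ u ≤ t := hz.2.1
    rw [hφ0] at h0
    rcases eq_or_lt_of_le h0 with h | h
    · exfalso; apply hyz
      funext i; rw [Subsingleton.elim i 0]
      show z (Fin.natAdd k 0) = 0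
      rw [← hlast]; exact h.symm
    · exact h
  have hupart : upart 1 z = u := by rw [← hzw, upart_snoc, upart_zero]
  have hdu : dist (u : Fin k → ℝ) a < δ := by
    have h := hdz; rw [dist_spinePt_eq, hupart] at h; exact (le_max_left _ _).trans_lt h
  have hynorm : ‖ypart 1 z‖ = t := by rw [norm_ypart_one, abs_of_pos htpos]
  have htψ : t ≤ ℓ.ψ u := hz.2.2
  -- points of the slice `(u, s)`, `0 < s ≤ t`
  have hslice : ∀ s ∈ Ioc 0 t, (Fin.snoc u s : Fin (k + 0 + 1) → ℝ) ∈ pAngle Ω 1 ⟨T, ℓ⟩ ∧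
      dist (Fin.snoc u s : Fin (k + 0 + 1) → ℝ) (spinePt 1 a) < δ := by
    intro s hs
    refine ⟨⟨snoc_mem_angle_succ.2 ⟨huA, by rw [hφ0]; exact hs.1.le, hs.2.trans htψ⟩, ?_⟩, ?_⟩
    · rw [ypart_snoc, ypart_zero]
      intro h; have := congrFun h (Fin.last 0)
      simp only [Fin.snoc_last, Pi.zero_apply] at this
      exact hs.1.ne' this
    · rw [dist_spinePt_eq, upart_snoc, upart_zero, ypart_snoc, ypart_zero, norm_snoc_fin_zero, abs_of_pos hs.1]
      refine max_lt hdu (lt_of_le_of_lt hs.2 ?_)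
      have h := hdz; rw [dist_spinePt_eq, hynorm] at h; exact (le_max_right _ _).trans_lt h
  -- the mean value theorem for `s ↦ f (u, s) - G₀ s` on `[s₀, t]`, then `s₀ → 0⁺`
  set φ : ℝ → ℝ := fun s => f (Fin.snoc u s) - Gv 0 * s with hφdef
  have hder : ∀ s ∈ Ioc 0 t, HasDerivAt φ (partialDeriv f (Fin.last (k + 0)) (Fin.snoc u s) - Gv 0) s := by
    intro s hs
    obtain ⟨hmem, hdist⟩ := hslice s hs
    have hU : (Fin.snoc u s : Fin (k + 0 + 1) → ℝ) ∈ U := hsub _ hmem.1 (hdist.trans_le ((min_le_right _ _).trans (min_le_right _ _))) hmem.2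
    have h1 := hasDerivAt_normal_slice ((hd _ hU).differentiableAt (hUo.mem_nhds hU))
    have h2 : HasDerivAt (fun s : ℝ => Gv 0 * s) (Gv 0) s := by simpa using (hasDerivAt_id s).const_mul (Gv 0)
    exact h1.sub h2
  have hbound : ∀ s ∈ Ioc 0 t, ‖partialDeriv f (Fin.last (k + 0)) (Fin.snoc u s) - Gv 0‖ ≤ ε := by
    intro s hs
    obtain ⟨hmem, hdist⟩ := hslice s hs
    have h := hOsub _ (hball _ hmem (hdist.trans_le (min_le_left _ _)))
    rw [dist_eq_norm] at h
    simpa only [partialDeriv, hlast] using h.le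
  have hMVT : ∀ s₀ ∈ Ioc 0 t, |φ t - φ s₀| ≤ ε * (t - s₀) := by
    intro s₀ hs₀
    have hIcc : Icc s₀ t ⊆ Ioc 0 t := fun s hs => ⟨hs₀.1.trans_le hs.1, hs.2⟩
    have h := (convex_Icc s₀ t).norm_image_sub_le_of_norm_hasDerivWithin_le
      (fun s hs => (hder s (hIcc hs)).hasDerivWithinAt) (fun s hs => hbound s (hIcc hs))
      (left_mem_Icc.2 hs₀.2) (right_mem_Icc.2 hs₀.2)
    rw [Real.norm_eq_abs, Real.norm_eq_abs, abs_of_nonneg (sub_nonneg.2 hs₀.2)] at h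
    exact h
  have hφlim : Tendsto φ (𝓝[>] 0) (𝓝 (spineLim 1 ⟨T, ℓ⟩ f u)) := by
    have h1 := hlim u (hdu.trans_le ((min_le_right _ _).trans (min_le_left _ _)))
    have h2 : Tendsto (fun s : ℝ => Gv 0 * s) (𝓝[>] 0) (𝓝 0) := by
      have hc : Continuous fun s : ℝ => Gv 0 * s := continuous_const.mul continuous_id
      have h := hc.tendsto (0 : ℝ)
      rw [mul_zero] at h
      exact h.mono_left nhdsWithin_le_nhds
    have h := h1.sub h2
    rwa [sub_zero] at h
  have hfinal : |φ t - spineLim 1 ⟨T, ℓ⟩ f u| ≤ ε * t := by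
    have hev : ∀ᶠ s₀ in 𝓝[>] 0, |φ t - φ s₀| ≤ ε * t := by
      filter_upwards [Ioo_mem_nhdsGT htpos] with s₀ hs₀
      exact (hMVT s₀ ⟨hs₀.1, hs₀.2.le⟩).trans (by nlinarith [hs₀.1, hε.le])
    have hcont : Tendsto (fun s₀ => |φ t - φ s₀|) (𝓝[>] 0) (𝓝 |φ t - spineLim 1 ⟨T, ℓ⟩ f u|) :=
      (continuous_abs.tendsto _).comp (tendsto_const_nhds.sub hφlim)
    exact le_of_tendsto hcont hev
  -- rewrite in terms of `z`
  rw [hupart, hynorm, Fin.sum_univ_one]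
  have hy0 : ypart 1 z 0 = t := by rw [← hzw, ypart_snoc, ypart_zero]; rfl
  rw [hy0]
  have hzφ : f z - spineLim 1 ⟨T, ℓ⟩ f u - Gv 0 * t = φ t - spineLim 1 ⟨T, ℓ⟩ f u := by
    simp only [hφdef]; rw [hzw]; ring
  rw [hzφ]; exact hfinal

/-! ### Linear algebra: the fibre displacement -/

/-- `w - spinePt (upart w) = append 0 (ypart w)`. [cite: Pawlucki2024, Lemma 5.4] -/
theorem sub_spinePt_upart (j : ℕ) (w : Fin (k + j) → ℝ) :
    w - spinePt j (upart j w) = Fin.append (0 : Fin k → ℝ) (ypart j w) := by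
  funext i
  refine Fin.addCases (fun l => ?_) (fun l => ?_) i
  · simp [spinePt, upart]
  · simp [spinePt, ypart]

/-- `append 0 y = Σ yᵢ eᵢ`. [folklore] -/
theorem append_zero_eq_sum (j : ℕ) (y : Fin j → ℝ) :
    (Fin.append (0 : Fin k → ℝ) y : Fin (k + j) → ℝ) = ∑ i, y i • (Pi.single (Fin.natAdd k i) (1 : ℝ) : Fin (k + j) → ℝ) := by
  funext l
  rw [Finset.sum_apply]
  refine Fin.addCases (fun l' => ?_) (fun l' => ?_) l
  · rw [Fin.append_left]
    simp only [Pi.smul_apply, Pi.single_apply, smul_eq_mul]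
    rw [Finset.sum_eq_zero]; · rfl
    intro i _
    rw [if_neg]; · simp
    intro h
    have := congrArg Fin.val h
    simp at this; omega
  · rw [Fin.append_right]
    simp only [Pi.smul_apply, Pi.single_apply, smul_eq_mul]
    rw [Finset.sum_eq_single l']
    · simp
    · intro i _ hi
      rw [if_neg]; · simp
      intro h; exact hi (Fin.natAdd_injective _ _ h.symm)
    · intro h; exact absurd (Finset.mem_univ _) h

/-- The norm of the fibre displacement. [cite: Pawlucki2024, Lemma 5.4] -/
theorem norm_sub_spinePt_upart (j : ℕ) (w : Fin (k + j) → ℝ) : ‖w - spinePt j (upart j w)‖ = ‖ypart j w‖ := by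
  rw [← dist_eq_norm, dist_spinePt_eq, dist_self, max_eq_right (norm_nonneg _)]

/-- `ypart (j+1) z` as `snoc`. [cite: Pawlucki2024, Lemma 5.4] -/
theorem ypart_succ_eq_snoc (j : ℕ) (z : Fin (k + (j + 1)) → ℝ) :
    ypart (j + 1) z = Fin.snoc (ypart j (Fin.init z)) (z (Fin.last (k + j))) := by
  rw [← Fin.snoc_init_self (ypart (j + 1) z), ← ypart_init, ypart_last]

/-! ### The induction step -/

/-- **Induction step of the first-order vertex estimate.** [cite: Pawlucki2024, Lemma 5.4 (proof)] -/
theorem vertex_deriv_succ {Ω : Set (Fin k → ℝ)} (hΩ : IsOpen Ω) (j : ℕ) (T : Tower k (j + 1)) (ℓ' : Level (k + (j + 1)))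
    (H : Tower.Hyp Ω (j + 1 + 1) ⟨T, ℓ'⟩) {a : Fin k → ℝ} (ha : a ∈ Ω)
    (IH : ∀ (f : (Fin (k + (j + 1)) → ℝ) → ℝ) (Gv : Fin (j + 1) → ℝ),
      (∃ R : ℝ, 0 < R ∧ ∃ M : ℝ, 0 ≤ M ∧ GradHyp Ω (j + 1) T a R M f) → DerivHyp Ω (j + 1) T a f Gv → VertexDerivEst Ω (j + 1) T a f Gv)
    {f : (Fin (k + (j + 1 + 1)) → ℝ) → ℝ} {Gv : Fin (j + 1 + 1) → ℝ}
    (hf : ∃ R : ℝ, 0 < R ∧ ∃ M : ℝ, 0 ≤ M ∧ GradHyp Ω (j + 1 + 1) ⟨T, ℓ'⟩ a R M f) (hD : DerivHyp Ω (j + 1 + 1) ⟨T, ℓ'⟩ a f Gv) :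
    VertexDerivEst Ω (j + 1 + 1) ⟨T, ℓ'⟩ a f Gv := by
  obtain ⟨T₀, ℓ₀⟩ := T
  have Hfull := H
  obtain ⟨HT, ⟨V, hVo, hAV, hφ, -⟩, hle, hpinch, -⟩ := H
  set T : Tower k (j + 1) := (T₀, ℓ₀) with hTdef
  set pt := spinePt (j + 1) a with hpt
  have hpt_mem : pt ∈ angle Ω (j + 1) T := spinePt_mem_angle ha (j + 1) T HT
  have hptV : pt ∈ V := hAV hpt_mem
  obtain ⟨R, hR, M, hM, hGrad⟩ := hf
  obtain ⟨U, hUo, hsub, hd, hgrad⟩ := hGrad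
  -- constants of the lower tower and of `φ'`
  obtain ⟨C, hC0, hVE⟩ := vertex_estimate hΩ ha j T HT
  set L : ℝ := ‖fderiv ℝ ℓ'.φ pt‖ + 1 with hL
  have hL0 : 0 ≤ L := by positivity
  have hφd : DifferentiableOn ℝ ℓ'.φ V := hφ.differentiableOn one_ne_zero
  have hφdc : ContinuousAt (fun w => fderiv ℝ ℓ'.φ w) pt := (hφ.continuousOn_fderiv_of_isOpen hVo le_rfl).continuousAt (hVo.mem_nhds hptV)
  obtain ⟨RL, hRL, hRLV, hRLbd⟩ : ∃ RL > 0, ball pt RL ⊆ V ∧ ∀ w ∈ ball pt RL, ‖fderiv ℝ ℓ'.φ w‖ ≤ L := by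
    have h1 : ∀ᶠ w in 𝓝 pt, dist (fderiv ℝ ℓ'.φ w) (fderiv ℝ ℓ'.φ pt) < 1 := Metric.tendsto_nhds.1 hφdc.tendsto 1 one_pos
    obtain ⟨RL, hRL, h⟩ := Metric.eventually_nhds_iff.1 (h1.and (hVo.mem_nhds hptV))
    refine ⟨RL, hRL, fun w hw => (h hw).2, fun w hw => ?_⟩
    have h' := (h (mem_ball.1 hw)).1
    rw [dist_eq_norm] at h'
    calc ‖fderiv ℝ ℓ'.φ w‖ = ‖(fderiv ℝ ℓ'.φ w - fderiv ℝ ℓ'.φ pt) + fderiv ℝ ℓ'.φ pt‖ := by rw [sub_add_cancel]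
      _ ≤ ‖fderiv ℝ ℓ'.φ w - fderiv ℝ ℓ'.φ pt‖ + ‖fderiv ℝ ℓ'.φ pt‖ := norm_add_le _ _
      _ ≤ L := by rw [hL]; linarith
  have hφGrad : GradHyp Ω (j + 1) T a RL L ℓ'.φ := by
    refine ⟨V, hVo, fun z hz _ _ => hAV hz, hφd, fun z hz hdz _ i => ?_⟩
    calc |(fderiv ℝ ℓ'.φ z) (Pi.single (Fin.natAdd k i) 1)| = ‖(fderiv ℝ ℓ'.φ z) (Pi.single (Fin.natAdd k i) 1)‖ := (Real.norm_eq_abs _).symm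
      _ ≤ ‖fderiv ℝ ℓ'.φ z‖ * ‖(Pi.single (Fin.natAdd k i) (1 : ℝ) : Fin (k + (j + 1)) → ℝ)‖ := ContinuousLinearMap.le_opNorm _ _
      _ ≤ L * 1 := by rw [norm_single_one]; exact mul_le_mul_of_nonneg_right (hRLbd z (mem_ball.2 hdz)) zero_le_one
      _ = L := mul_one L
  obtain ⟨Rφ, hRφ, hφest⟩ := hVE RL hRL
  have hφbd : ∀ w ∈ angle Ω (j + 1) T, dist w pt < Rφ → ypart (j + 1) w ≠ 0 → |ℓ'.φ w| ≤ C * L * ‖ypart (j + 1) w‖ := by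
    intro w hw hdw hyw
    have h := hφest L ℓ'.φ hL0 hφGrad w hw hdw hyw
    have huΩ : upart (j + 1) w ∈ Ω := upart_mem_of_mem_angle (j + 1) T hw
    have hsp : spinePt (j + 1) (upart (j + 1) w) ∈ angle Ω (j + 1) T := spinePt_mem_angle huΩ (j + 1) T HT
    have hcont : ContinuousWithinAt ℓ'.φ (angle Ω (j + 1) T) (spinePt (j + 1) (upart (j + 1) w)) :=
      ((hφ.continuousOn _ (hAV hsp)).continuousAt (hVo.mem_nhds (hAV hsp))).continuousWithinAt
    rw [spineLim_eq_of_continuousWithinAt j T HT huΩ hcont, (hpinch _ hsp (ypart_spinePt _ _)).1, sub_zero] at h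
    exact h
  -- the bottom graph map, the restricted function, its `GradHyp`
  set G : (Fin (k + (j + 1)) → ℝ) → (Fin (k + (j + 1) + 1) → ℝ) := fun w => Fin.snoc w (ℓ'.φ w) with hGdef
  set ft : (Fin (k + (j + 1)) → ℝ) → ℝ := fun w => f (G w) with hft
  have hGmem : ∀ w ∈ angle Ω (j + 1) T, G w ∈ angle Ω (j + 1 + 1) ⟨T, ℓ'⟩ := fun w hw =>
    snoc_mem_angle_succ.2 ⟨hw, le_rfl, hle w hw⟩
  have hGy_ne : ∀ (w : Fin (k + (j + 1)) → ℝ) (s : ℝ), ypart (j + 1) w ≠ 0 → ypart (j + 1 + 1) (Fin.snoc w s : Fin (k + (j + 1) + 1) → ℝ) ≠ 0 := by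
    intro w s hw h
    apply hw
    have h' := congrArg Fin.init (ypart_snoc (j + 1) w s)
    rw [h, Fin.init_snoc] at h'
    rw [← h']; rfl
  have hG0 : G pt = spinePt (j + 1 + 1) a := by
    show Fin.snoc pt (ℓ'.φ pt) = spinePt (j + 1 + 1) a
    rw [(hpinch _ hpt_mem (ypart_spinePt _ _)).1, hpt, snoc_spinePt_zero]
  set K : ℝ := 2 + C * L with hK
  have hKpos : 0 < K := by rw [hK]; nlinarith
  set Rt : ℝ := min RL (min Rφ (R / K)) with hRt
  have hRtpos : 0 < Rt := lt_min hRL (lt_min hRφ (div_pos hR hKpos))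
  have hRtRL : Rt ≤ RL := min_le_left _ _
  have hRtRφ : Rt ≤ Rφ := (min_le_right _ _).trans (min_le_left _ _)
  have hRtK : Rt ≤ R / K := (min_le_right _ _).trans (min_le_right _ _)
  have hgrow : (1 + C * L) * Rt < R := by
    have h1 : (1 + C * L) * Rt ≤ (1 + C * L) * (R / K) := mul_le_mul_of_nonneg_left hRtK (by positivity)
    have h2 : (1 + C * L) * (R / K) < R := by rw [← mul_div_assoc, div_lt_iff₀ hKpos]; nlinarith
    linarith
  -- scale control: `dist w pt ≤ D < Rt`, `|s| ≤ (1 + C L) D` ⇒ `dist (w, s) (spinePt (j + 1 + 1) a) < R`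
  have hdist_snoc : ∀ (w : Fin (k + (j + 1)) → ℝ) (s D : ℝ), dist w pt ≤ D → D < Rt → |s| ≤ (1 + C * L) * D →
      dist (Fin.snoc w s : Fin (k + (j + 1) + 1) → ℝ) (spinePt (j + 1 + 1) a) < R ∧ dist (Fin.snoc w s : Fin (k + (j + 1) + 1) → ℝ) (spinePt (j + 1 + 1) a) ≤ (1 + C * L) * D := by
    intro w s D hdw hD hs
    rw [show dist (Fin.snoc w s : Fin (k + (j + 1) + 1) → ℝ) (spinePt (j + 1 + 1) a) =
        max (dist (upart (j + 1) w) a) ‖(Fin.snoc (ypart (j + 1) w) s : Fin (j + 1 + 1) → ℝ)‖ from by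
      rw [← upart_snoc (j + 1) w s, ← ypart_snoc (j + 1) w s]; exact dist_spinePt_eq (j + 1 + 1) _ a, norm_snoc_max]
    rw [dist_spinePt_eq] at hdw
    have hD0 : 0 ≤ D := le_trans (le_max_of_le_left dist_nonneg) hdw
    have hCL : 1 ≤ 1 + C * L := by nlinarith
    have hDR : (1 + C * L) * D < R := lt_of_le_of_lt (mul_le_mul_of_nonneg_left hD.le (by positivity)) hgrow
    have hDD : D ≤ (1 + C * L) * D := le_mul_of_one_le_left hD0 hCL
    have hmax : max (dist (upart (j + 1) w) a) (max ‖ypart (j + 1) w‖ |s|) ≤ (1 + C * L) * D :=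
      max_le ((le_max_left _ _).trans hdw |>.trans hDD) (max_le ((le_max_right _ _).trans hdw |>.trans hDD) hs)
    exact ⟨hmax.trans_lt hDR, hmax⟩
  have hGgood : ∀ w ∈ angle Ω (j + 1) T, dist w pt < Rt → ypart (j + 1) w ≠ 0 →
      G w ∈ angle Ω (j + 1 + 1) ⟨T, ℓ'⟩ ∧ dist (G w) (spinePt (j + 1 + 1) a) < R ∧ ypart (j + 1 + 1) (G w) ≠ 0 ∧ dist (G w) (spinePt (j + 1 + 1) a) ≤ (1 + C * L) * dist w pt := by
    intro w hw hdw hyw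
    have hφw : |ℓ'.φ w| ≤ (1 + C * L) * dist w pt := by
      calc |ℓ'.φ w| ≤ C * L * ‖ypart (j + 1) w‖ := hφbd w hw (hdw.trans_le hRtRφ) hyw
        _ ≤ (1 + C * L) * dist w pt := by
            rw [dist_spinePt_eq]
            have h1 : ‖ypart (j + 1) w‖ ≤ max (dist (upart (j + 1) w) a) ‖ypart (j + 1) w‖ := le_max_right _ _
            have h2 : 0 ≤ max (dist (upart (j + 1) w) a) ‖ypart (j + 1) w‖ := le_max_of_le_left dist_nonneg
            calc C * L * ‖ypart (j + 1) w‖ ≤ C * L * max (dist (upart (j + 1) w) a) ‖ypart (j + 1) w‖ :=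
                  mul_le_mul_of_nonneg_left h1 (mul_nonneg hC0 hL0)
              _ ≤ (1 + C * L) * max (dist (upart (j + 1) w) a) ‖ypart (j + 1) w‖ := by
                  rw [add_mul, one_mul]; exact le_add_of_nonneg_left h2
    obtain ⟨h1, h2⟩ := hdist_snoc w _ (dist w pt) le_rfl hdw hφw
    exact ⟨hGmem w hw, h1, hGy_ne w _ hyw, h2⟩
  have hGcont : ContinuousOn G V := fun w hw =>
    (continuous_snoc_pair.continuousAt.comp_continuousWithinAt (continuousWithinAt_id.prodMk (hφ.continuousOn w hw)))
  set Ut : Set (Fin (k + (j + 1)) → ℝ) := V ∩ G ⁻¹' U with hUt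
  have hUto : IsOpen Ut := hGcont.isOpen_inter_preimage hVo hUo
  have hGder : ∀ w ∈ V, HasFDerivAt G ((snocCLM (k + (j + 1))).comp ((ContinuousLinearMap.id ℝ _).prod (fderiv ℝ ℓ'.φ w))) w :=
    fun w hw => hasFDerivAt_snoc_graph ((hφd w hw).differentiableAt (hVo.mem_nhds hw)).hasFDerivAt
  have hftder : ∀ w ∈ Ut, HasFDerivAt ft ((fderiv ℝ f (G w)).comp
      ((snocCLM (k + (j + 1))).comp ((ContinuousLinearMap.id ℝ _).prod (fderiv ℝ ℓ'.φ w)))) w := by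
    intro w hw
    have hf' : HasFDerivAt f (fderiv ℝ f (G w)) (G w) := ((hd _ hw.2).differentiableAt (hUo.mem_nhds hw.2)).hasFDerivAt
    exact hf'.comp w (hGder w hw.1)
  have hlast : Fin.last (k + (j + 1)) = Fin.natAdd k (Fin.last (j + 1)) := Fin.ext rfl
  -- the chain rule on `e_i`
  have hchain : ∀ w ∈ Ut, ∀ i : Fin (j + 1), fderiv ℝ ft w (Pi.single (Fin.natAdd k i) 1) =
      fderiv ℝ f (G w) (Pi.single (Fin.natAdd k i.castSucc) 1) +
        fderiv ℝ ℓ'.φ w (Pi.single (Fin.natAdd k i) 1) * fderiv ℝ f (G w) (Pi.single (Fin.natAdd k (Fin.last (j + 1))) 1) := by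
    intro w hw i
    rw [(hftder w hw).fderiv]
    have hGe : ((snocCLM (k + (j + 1))).comp ((ContinuousLinearMap.id ℝ _).prod (fderiv ℝ ℓ'.φ w)))
        (Pi.single (Fin.natAdd k i) 1) =
        (Pi.single (Fin.natAdd k i.castSucc) (1 : ℝ) : Fin (k + (j + 1) + 1) → ℝ) +
          (fderiv ℝ ℓ'.φ w (Pi.single (Fin.natAdd k i) 1)) • (Pi.single (Fin.natAdd k (Fin.last (j + 1))) (1 : ℝ) : Fin (k + (j + 1) + 1) → ℝ) := by
      simp only [ContinuousLinearMap.comp_apply, ContinuousLinearMap.prod_apply, ContinuousLinearMap.id_apply, snocCLM_apply]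
      rw [snoc_eq_add_smul, snoc_single_zero, snoc_zero_one, ← hlast]
      have : (Fin.natAdd k i).castSucc = Fin.natAdd k i.castSucc := Fin.ext rfl
      rw [this]
    rw [ContinuousLinearMap.comp_apply, hGe, map_add, map_smul, smul_eq_mul]
  have hgoodUt : ∀ w ∈ angle Ω (j + 1) T, dist w pt < Rt → ypart (j + 1) w ≠ 0 → w ∈ Ut := by
    intro w hw hdw hyw
    obtain ⟨h1, h2, h3, -⟩ := hGgood w hw hdw hyw
    exact ⟨hRLV (mem_ball.2 (hdw.trans_le hRtRL)), hsub _ h1 h2 h3⟩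
  have hftGrad : GradHyp Ω (j + 1) T a Rt (M * (1 + L)) ft := by
    refine ⟨Ut, hUto, hgoodUt, fun w hw => (hftder w hw).differentiableAt.differentiableWithinAt, fun w hw hdw hyw i => ?_⟩
    obtain ⟨h1, h2, h3, -⟩ := hGgood w hw hdw hyw
    rw [hchain w (hgoodUt w hw hdw hyw) i]
    have hA := hgrad _ h1 h2 h3 i.castSucc
    have hB := hgrad _ h1 h2 h3 (Fin.last (j + 1))
    have hcL : |fderiv ℝ ℓ'.φ w (Pi.single (Fin.natAdd k i) 1)| ≤ L := by
      calc |fderiv ℝ ℓ'.φ w (Pi.single (Fin.natAdd k i) 1)| = ‖(fderiv ℝ ℓ'.φ w) (Pi.single (Fin.natAdd k i) 1)‖ := (Real.norm_eq_abs _).symm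
        _ ≤ ‖fderiv ℝ ℓ'.φ w‖ * ‖(Pi.single (Fin.natAdd k i) (1 : ℝ) : Fin (k + (j + 1)) → ℝ)‖ := ContinuousLinearMap.le_opNorm _ _
        _ ≤ L * 1 := by rw [norm_single_one]; exact mul_le_mul_of_nonneg_right (hRLbd w (mem_ball.2 (hdw.trans_le hRtRL))) zero_le_one
        _ = L := mul_one L
    calc |fderiv ℝ f (G w) (Pi.single (Fin.natAdd k i.castSucc) 1) +
          fderiv ℝ ℓ'.φ w (Pi.single (Fin.natAdd k i) 1) * fderiv ℝ f (G w) (Pi.single (Fin.natAdd k (Fin.last (j + 1))) 1)|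
        ≤ |fderiv ℝ f (G w) (Pi.single (Fin.natAdd k i.castSucc) 1)| +
          |fderiv ℝ ℓ'.φ w (Pi.single (Fin.natAdd k i) 1)| * |fderiv ℝ f (G w) (Pi.single (Fin.natAdd k (Fin.last (j + 1))) 1)| := by
            rw [← abs_mul]; exact abs_add_le _ _
      _ ≤ M + L * M := add_le_add hA (mul_le_mul hcL hB (abs_nonneg _) hL0)
      _ = M * (1 + L) := by ring
  -- `G → p` within the punctured angles
  have hGt : Tendsto G (𝓝[pAngle Ω (j + 1) T] pt) (𝓝[pAngle Ω (j + 1 + 1) ⟨T, ℓ'⟩] (spinePt (j + 1 + 1) a)) := by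
    refine tendsto_nhdsWithin_iff.2 ⟨?_, ?_⟩
    · rw [← hG0]
      exact ((hGcont pt hptV).continuousAt (hVo.mem_nhds hptV)).continuousWithinAt.tendsto.mono_left (nhdsWithin_mono _ fun _ h => h) |>.mono_right le_rfl
    · filter_upwards [self_mem_nhdsWithin] with w hw
      exact ⟨hGmem w hw.1, hGy_ne w _ hw.2⟩
  -- the limits of the `y`-partials of `ft`
  set Gt : Fin (j + 1) → ℝ := fun i => Gv i.castSucc + fderiv ℝ ℓ'.φ pt (Pi.single (Fin.natAdd k i) 1) * Gv (Fin.last (j + 1)) with hGt_def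
  have hftD : DerivHyp Ω (j + 1) T a ft Gt := by
    intro i
    have h1 : Tendsto (fun w => fderiv ℝ f (G w) (Pi.single (Fin.natAdd k i.castSucc) 1)) (𝓝[pAngle Ω (j + 1) T] pt) (𝓝 (Gv i.castSucc)) :=
      (hD i.castSucc).comp hGt
    have h2 : Tendsto (fun w => fderiv ℝ f (G w) (Pi.single (Fin.natAdd k (Fin.last (j + 1))) 1)) (𝓝[pAngle Ω (j + 1) T] pt) (𝓝 (Gv (Fin.last (j + 1)))) :=
      (hD (Fin.last (j + 1))).comp hGt
    have h3 : Tendsto (fun w => fderiv ℝ ℓ'.φ w (Pi.single (Fin.natAdd k i) 1)) (𝓝[pAngle Ω (j + 1) T] pt)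
        (𝓝 (fderiv ℝ ℓ'.φ pt (Pi.single (Fin.natAdd k i) 1))) :=
      (hφdc.clm_apply continuousAt_const).tendsto.mono_left nhdsWithin_le_nhds
    have h := h1.add (h3.mul h2)
    refine h.congr' ?_
    have hev : ∀ᶠ w in 𝓝[pAngle Ω (j + 1) T] pt, w ∈ Ut := by
      have hb : ∀ᶠ w in 𝓝[pAngle Ω (j + 1) T] pt, dist w pt < Rt := mem_nhdsWithin_of_mem_nhds (ball_mem_nhds pt hRtpos)
      filter_upwards [hb, self_mem_nhdsWithin] with w hw hw'
      exact hgoodUt w hw'.1 hw hw'.2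
    filter_upwards [hev] with w hw
    exact (hchain w hw i).symm
  -- the induction hypothesis for `ft`
  have hIH := IH ft Gt ⟨Rt, hRtpos, M * (1 + L), by positivity, hftGrad⟩ hftD
  -- the estimate
  intro ε hε
  set D : ℝ := 2 + C * L + |Gv (Fin.last (j + 1))| with hDdef
  have hDpos : 0 < D := by rw [hDdef]; have := abs_nonneg (Gv (Fin.last (j + 1))); nlinarith
  set ε₁ : ℝ := ε / D with hε₁
  have hε₁pos : 0 < ε₁ := div_pos hε hDpos
  obtain ⟨δIH, hδIH, hIHest⟩ := hIH ε₁ hε₁pos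
  -- `|∂_last f - G_last| ≤ ε₁` near `p`
  obtain ⟨δD, hδD, hDlast⟩ : ∃ δD > 0, ∀ z ∈ pAngle Ω (j + 1 + 1) ⟨T, ℓ'⟩, dist z (spinePt (j + 1 + 1) a) < δD →
      |fderiv ℝ f z (Pi.single (Fin.natAdd k (Fin.last (j + 1))) 1) - Gv (Fin.last (j + 1))| ≤ ε₁ := by
    have h := Metric.tendsto_nhds.1 (hD (Fin.last (j + 1))) ε₁ hε₁pos
    obtain ⟨O, hO, hOsub⟩ := eventually_iff_exists_mem.1 h
    obtain ⟨O', hO', hO'sub⟩ := mem_nhdsWithin_iff_exists_mem_nhds_inter.1 hO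
    obtain ⟨δD, hδD, hb⟩ := Metric.mem_nhds_iff.1 hO'
    refine ⟨δD, hδD, fun z hz hdz => ?_⟩
    have := hOsub z (hO'sub ⟨hb hdz, hz⟩)
    rw [Real.dist_eq] at this; exact this.le
  -- linearization of `φ'` on a ball around `pt`: `|φ' w - Dφ'(pt)(w - sp w)| ≤ ε₁ ‖y_w‖`
  obtain ⟨rφ, hrφ, hlin⟩ : ∃ rφ > 0, ∀ w ∈ angle Ω (j + 1) T, dist w pt < rφ →
      |ℓ'.φ w - ∑ i : Fin (j + 1), ypart (j + 1) w i * fderiv ℝ ℓ'.φ pt (Pi.single (Fin.natAdd k i) 1)| ≤ ε₁ * ‖ypart (j + 1) w‖ := by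
    have h1 : ∀ᶠ w in 𝓝 pt, dist (fderiv ℝ ℓ'.φ w) (fderiv ℝ ℓ'.φ pt) < ε₁ := Metric.tendsto_nhds.1 hφdc.tendsto ε₁ hε₁pos
    obtain ⟨rφ, hrφ, hb⟩ := Metric.eventually_nhds_iff.1 (h1.and (hVo.mem_nhds hptV))
    refine ⟨rφ, hrφ, fun w hw hdw => ?_⟩
    have huΩ : upart (j + 1) w ∈ Ω := upart_mem_of_mem_angle (j + 1) T hw
    set sp := spinePt (j + 1) (upart (j + 1) w) with hsp
    have hsp_mem : sp ∈ angle Ω (j + 1) T := spinePt_mem_angle huΩ (j + 1) T HT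
    have hφsp : ℓ'.φ sp = 0 := (hpinch _ hsp_mem (ypart_spinePt _ _)).1
    have hdsp : dist sp pt < rφ := by
      have h : dist sp pt ≤ dist w pt := by
        rw [hsp, hpt, dist_spinePt_eq, dist_spinePt_eq, upart_spinePt, ypart_spinePt, norm_zero]
        exact max_le (le_max_left _ _) (le_max_of_le_left dist_nonneg)
      exact h.trans_lt hdw
    have hball_der : ∀ x ∈ ball pt rφ, HasFDerivWithinAt ℓ'.φ (fderiv ℝ ℓ'.φ x) (ball pt rφ) x := fun x hx =>
      (((hφd x (hb hx).2).differentiableAt (hVo.mem_nhds (hb hx).2)).hasFDerivAt).hasFDerivWithinAt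
    have hbound : ∀ x ∈ ball pt rφ, ‖fderiv ℝ ℓ'.φ x - fderiv ℝ ℓ'.φ pt‖ ≤ ε₁ := fun x hx => by
      have := (hb hx).1; rw [dist_eq_norm] at this; exact this.le
    have h := (convex_ball pt rφ).norm_image_sub_le_of_norm_hasFDerivWithin_le' hball_der hbound (mem_ball.2 hdsp) (mem_ball.2 hdw)
    rw [hφsp, sub_zero, hsp, norm_sub_spinePt_upart, sub_spinePt_upart, append_zero_eq_sum, map_sum, Real.norm_eq_abs] at h
    have hs : ∑ x : Fin (j + 1), (fderiv ℝ ℓ'.φ pt) (ypart (j + 1) w x • (Pi.single (Fin.natAdd k x) (1 : ℝ) : Fin (k + (j + 1)) → ℝ)) =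
        ∑ i : Fin (j + 1), ypart (j + 1) w i * fderiv ℝ ℓ'.φ pt (Pi.single (Fin.natAdd k i) 1) :=
      Finset.sum_congr rfl fun i _ => by rw [map_smul, smul_eq_mul]
    rw [hs] at h
    exact h
  -- the radius
  set δ : ℝ := min δIH (min rφ (min Rt (δD / (1 + C * L)))) with hδ
  have hCL1 : 0 < 1 + C * L := by nlinarith
  have hδpos : 0 < δ := lt_min hδIH (lt_min hrφ (lt_min hRtpos (div_pos hδD hCL1)))
  have hδIH' : δ ≤ δIH := min_le_left _ _
  have hδrφ : δ ≤ rφ := (min_le_right _ _).trans (min_le_left _ _)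
  have hδRt : δ ≤ Rt := (min_le_right _ _).trans ((min_le_right _ _).trans (min_le_left _ _))
  have hδD' : (1 + C * L) * δ ≤ δD := by
    have h : δ ≤ δD / (1 + C * L) := (min_le_right _ _).trans ((min_le_right _ _).trans (min_le_right _ _))
    rw [le_div_iff₀ hCL1] at h; linarith
  refine ⟨δ, hδpos, fun z hz hdz hyz => ?_⟩
  -- decompose `z = snoc w t`
  set w := Fin.init z with hw_def
  set t := z (Fin.last (k + (j + 1))) with ht_def
  have hzw : z = Fin.snoc w t := (Fin.snoc_init_self z).symm
  have hw : w ∈ angle Ω (j + 1) T := hz.1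
  have hyw : ypart (j + 1) w ≠ 0 := ypart_init_ne_zero Hfull (Nat.succ_pos j) hz hyz
  have hdwz : dist w pt ≤ dist z (spinePt (j + 1 + 1) a) := dist_init_spinePt_le (j + 1) z a
  have hdw : dist w pt < δ := hdwz.trans_lt hdz
  have hφw : |ℓ'.φ w| ≤ C * L * ‖ypart (j + 1) w‖ := hφbd w hw (hdw.trans_le (hδRt.trans hRtRφ)) hyw
  have hyw_le : ‖ypart (j + 1) w‖ ≤ ‖ypart (j + 1 + 1) z‖ := norm_ypart_init_le (j + 1) z
  have ht_le : |t| ≤ ‖ypart (j + 1 + 1) z‖ := abs_last_le_norm_ypart (j + 1) z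
  have hyz_le : ‖ypart (j + 1 + 1) z‖ ≤ dist z (spinePt (j + 1 + 1) a) := by rw [dist_spinePt_eq]; exact le_max_right _ _
  have hφt : ℓ'.φ w ≤ t := hz.2.1
  -- the vertical segment: membership, distance, derivative bound
  have hseg : ∀ s ∈ Icc (ℓ'.φ w) t, (Fin.snoc w s : Fin (k + (j + 1) + 1) → ℝ) ∈ U ∧
      |partialDeriv f (Fin.last (k + (j + 1))) (Fin.snoc w s) - Gv (Fin.last (j + 1))| ≤ ε₁ := by
    intro s hs
    have hmem : (Fin.snoc w s : Fin (k + (j + 1) + 1) → ℝ) ∈ angle Ω (j + 1 + 1) ⟨T, ℓ'⟩ :=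
      snoc_mem_angle_succ.2 ⟨hw, hs.1, hs.2.trans hz.2.2⟩
    have hsbd : |s| ≤ (1 + C * L) * dist z (spinePt (j + 1 + 1) a) := by
      have h1 : |s| ≤ max |ℓ'.φ w| |t| := abs_le_max_abs_abs hs.1 hs.2
      have h2 : max |ℓ'.φ w| |t| ≤ (1 + C * L) * ‖ypart (j + 1 + 1) z‖ := by
        refine max_le ?_ ?_
        · calc |ℓ'.φ w| ≤ C * L * ‖ypart (j + 1) w‖ := hφw
            _ ≤ C * L * ‖ypart (j + 1 + 1) z‖ := mul_le_mul_of_nonneg_left hyw_le (mul_nonneg hC0 hL0)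
            _ ≤ (1 + C * L) * ‖ypart (j + 1 + 1) z‖ := by
                rw [add_mul, one_mul]; exact le_add_of_nonneg_left (norm_nonneg _)
        · calc |t| ≤ ‖ypart (j + 1 + 1) z‖ := ht_le
            _ ≤ (1 + C * L) * ‖ypart (j + 1 + 1) z‖ :=
                le_mul_of_one_le_left (norm_nonneg _) (le_add_of_nonneg_right (mul_nonneg hC0 hL0))
      exact h1.trans (h2.trans (mul_le_mul_of_nonneg_left hyz_le hCL1.le))
    obtain ⟨hdistR, hdistD⟩ := hdist_snoc w s (dist z (spinePt (j + 1 + 1) a)) hdwz (hdz.trans_le hδRt) hsbd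
    have hy := hGy_ne w s hyw
    refine ⟨hsub _ hmem hdistR hy, ?_⟩
    have hdD : dist (Fin.snoc w s : Fin (k + (j + 1) + 1) → ℝ) (spinePt (j + 1 + 1) a) < δD :=
      hdistD.trans_lt (lt_of_lt_of_le (mul_lt_mul_of_pos_left hdz hCL1) hδD')
    have h := hDlast _ ⟨hmem, hy⟩ hdD
    simpa only [partialDeriv, hlast] using h
  have hMVT : |f (Fin.snoc w t) - f (Fin.snoc w (ℓ'.φ w)) - Gv (Fin.last (j + 1)) * (t - ℓ'.φ w)| ≤ ε₁ * |t - ℓ'.φ w| := by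
    set φv : ℝ → ℝ := fun s => f (Fin.snoc w s) - Gv (Fin.last (j + 1)) * s with hφv
    have hder : ∀ s ∈ Icc (ℓ'.φ w) t, HasDerivWithinAt φv
        (partialDeriv f (Fin.last (k + (j + 1))) (Fin.snoc w s) - Gv (Fin.last (j + 1))) (Icc (ℓ'.φ w) t) s := by
      intro s hs
      have h1 := hasDerivAt_normal_slice ((hd _ (hseg s hs).1).differentiableAt (hUo.mem_nhds (hseg s hs).1))
      have h2 : HasDerivAt (fun s : ℝ => Gv (Fin.last (j + 1)) * s) (Gv (Fin.last (j + 1))) s := by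
        simpa using (hasDerivAt_id s).const_mul (Gv (Fin.last (j + 1)))
      exact (h1.sub h2).hasDerivWithinAt
    have h := (convex_Icc (ℓ'.φ w) t).norm_image_sub_le_of_norm_hasDerivWithin_le hder
      (fun s hs => by rw [Real.norm_eq_abs]; exact (hseg s hs).2) (left_mem_Icc.2 hφt) (right_mem_Icc.2 hφt)
    rw [Real.norm_eq_abs, Real.norm_eq_abs] at h
    have heq : φv t - φv (ℓ'.φ w) = f (Fin.snoc w t) - f (Fin.snoc w (ℓ'.φ w)) - Gv (Fin.last (j + 1)) * (t - ℓ'.φ w) := by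
      simp only [hφv]; ring
    rw [heq] at h; exact h
  have hIHw := hIHest w hw (hdw.trans_le hδIH') hyw
  have hlinw := hlin w hw (hdw.trans_le hδrφ)
  -- algebra
  have hyi : ∀ i : Fin (j + 1), ypart (j + 1 + 1) z i.castSucc = ypart (j + 1) w i := fun i => by
    rw [hw_def, ypart_init]; rfl
  have hylast : ypart (j + 1 + 1) z (Fin.last (j + 1)) = t := ypart_last (j + 1) z
  have hsum_z : ∑ i : Fin (j + 1 + 1), Gv i * ypart (j + 1 + 1) z i =
      (∑ i : Fin (j + 1), Gv i.castSucc * ypart (j + 1) w i) + Gv (Fin.last (j + 1)) * t := by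
    rw [Fin.sum_univ_castSucc, hylast]
    simp only [hyi]
  have hsum_t : ∑ i : Fin (j + 1), Gt i * ypart (j + 1) w i =
      (∑ i : Fin (j + 1), Gv i.castSucc * ypart (j + 1) w i) +
        Gv (Fin.last (j + 1)) * ∑ i : Fin (j + 1), ypart (j + 1) w i * fderiv ℝ ℓ'.φ pt (Pi.single (Fin.natAdd k i) 1) := by
    simp only [hGt_def, add_mul, Finset.sum_add_distrib, Finset.mul_sum]
    congr 1
    exact Finset.sum_congr rfl fun i _ => by ring
  have hg : spineLim (j + 1 + 1) ⟨T, ℓ'⟩ f (upart (j + 1 + 1) z) = spineLim (j + 1) T ft (upart (j + 1) w) := by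
    rw [hTdef, spineLim_succ_succ, ← upart_init]
  rw [hg, hsum_z]
  have hft_w : ft w = f (Fin.snoc w (ℓ'.φ w)) := rfl
  set S₁ := ∑ i : Fin (j + 1), Gv i.castSucc * ypart (j + 1) w i with hS₁
  set S₂ := ∑ i : Fin (j + 1), ypart (j + 1) w i * fderiv ℝ ℓ'.φ pt (Pi.single (Fin.natAdd k i) 1) with hS₂
  set gL := Gv (Fin.last (j + 1)) with hgL
  set gu := spineLim (j + 1) T ft (upart (j + 1) w) with hgu
  have key : f z - gu - (S₁ + gL * t) =
      (f (Fin.snoc w t) - f (Fin.snoc w (ℓ'.φ w)) - gL * (t - ℓ'.φ w)) +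
        (ft w - gu - ∑ i : Fin (j + 1), Gt i * ypart (j + 1) w i) + gL * (S₂ - ℓ'.φ w) := by
    rw [hsum_t, hft_w, ← hzw]; ring
  rw [key]
  have h3 : |gL * (S₂ - ℓ'.φ w)| ≤ |gL| * (ε₁ * ‖ypart (j + 1) w‖) := by
    rw [abs_mul]; refine mul_le_mul_of_nonneg_left ?_ (abs_nonneg _)
    rw [abs_sub_comm]; exact hlinw
  calc |f (Fin.snoc w t) - f (Fin.snoc w (ℓ'.φ w)) - gL * (t - ℓ'.φ w) +
        (ft w - gu - ∑ i : Fin (j + 1), Gt i * ypart (j + 1) w i) + gL * (S₂ - ℓ'.φ w)|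
      ≤ |f (Fin.snoc w t) - f (Fin.snoc w (ℓ'.φ w)) - gL * (t - ℓ'.φ w)| +
        |ft w - gu - ∑ i : Fin (j + 1), Gt i * ypart (j + 1) w i| + |gL * (S₂ - ℓ'.φ w)| :=
        (abs_add_le _ _).trans (add_le_add (abs_add_le _ _) le_rfl)
    _ ≤ ε₁ * |t - ℓ'.φ w| + ε₁ * ‖ypart (j + 1) w‖ + |gL| * (ε₁ * ‖ypart (j + 1) w‖) := add_le_add (add_le_add hMVT hIHw) h3
    _ ≤ ε₁ * ((1 + C * L) * ‖ypart (j + 1 + 1) z‖) + ε₁ * ‖ypart (j + 1 + 1) z‖ + |gL| * (ε₁ * ‖ypart (j + 1 + 1) z‖) := by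
        refine add_le_add (add_le_add (mul_le_mul_of_nonneg_left ?_ hε₁pos.le) (mul_le_mul_of_nonneg_left hyw_le hε₁pos.le))
          (mul_le_mul_of_nonneg_left (mul_le_mul_of_nonneg_left hyw_le hε₁pos.le) (abs_nonneg _))
        calc |t - ℓ'.φ w| ≤ |t| + |ℓ'.φ w| := abs_sub _ _
          _ ≤ ‖ypart (j + 1 + 1) z‖ + C * L * ‖ypart (j + 1 + 1) z‖ :=
              add_le_add ht_le (hφw.trans (mul_le_mul_of_nonneg_left hyw_le (mul_nonneg hC0 hL0)))
          _ = (1 + C * L) * ‖ypart (j + 1 + 1) z‖ := by ring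
    _ = ε₁ * D * ‖ypart (j + 1 + 1) z‖ := by rw [hDdef]; ring
    _ = ε * ‖ypart (j + 1 + 1) z‖ := by rw [hε₁, div_mul_cancel₀ _ hDpos.ne']

/-- **The first-order vertex estimate** (all levels). [cite: Pawlucki2024, Lemma 5.4 (proof)] -/
theorem vertex_deriv {Ω : Set (Fin k → ℝ)} (hΩ : IsOpen Ω) {a : Fin k → ℝ} (ha : a ∈ Ω) :
    ∀ (j : ℕ) (T : Tower k (j + 1)), Tower.Hyp Ω (j + 1) T → ∀ (f : (Fin (k + (j + 1)) → ℝ) → ℝ) (Gv : Fin (j + 1) → ℝ),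
      (∃ R : ℝ, 0 < R ∧ ∃ M : ℝ, 0 ≤ M ∧ GradHyp Ω (j + 1) T a R M f) → DerivHyp Ω (j + 1) T a f Gv → VertexDerivEst Ω (j + 1) T a f Gv
  | 0, ⟨T, ℓ⟩, H, _, _, ⟨_, hR, _, _, hf⟩, hD => vertex_deriv_one hΩ T ℓ H ha hR hf hD
  | j + 1, ⟨T, ℓ'⟩, H, _, _, hf, hD =>
    vertex_deriv_succ hΩ j T ℓ' H ha (fun f' Gv' hf' hD' => vertex_deriv hΩ ha j T H.1 f' Gv' hf' hD') hf hD

/-! ### Differentiability of the extension at the vertex -/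

/-- `upart` as a continuous linear map. [cite: Pawlucki2024, Lemma 5.4] -/
def upartL (k j : ℕ) : (Fin (k + j) → ℝ) →L[ℝ] (Fin k → ℝ) :=
  ContinuousLinearMap.pi fun i : Fin k => ContinuousLinearMap.proj (R := ℝ) (φ := fun _ : Fin (k + j) => ℝ) (Fin.castAdd j i)

/-- `upartL z = upart z`. [cite: Pawlucki2024, Lemma 5.4] -/
@[simp] theorem upartL_apply (j : ℕ) (z : Fin (k + j) → ℝ) : upartL k j z = upart j z := rfl

/-- The extension of `f` by its spine limit `g`. [cite: Pawlucki2024, Lemma 5.4] -/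
def angleExt (j : ℕ) (f : (Fin (k + j) → ℝ) → ℝ) (g : (Fin k → ℝ) → ℝ) (z : Fin (k + j) → ℝ) : ℝ := by
  classical
  exact if ypart j z = 0 then g (upart j z) else f z

/-- The candidate derivative at the vertex: `(Dg(a), G)`. [cite: Pawlucki2024, Lemma 5.4] -/
def vertexDeriv (k j : ℕ) (g' : (Fin k → ℝ) →L[ℝ] ℝ) (Gv : Fin j → ℝ) : (Fin (k + j) → ℝ) →L[ℝ] ℝ :=
  g'.comp (upartL k j) + ∑ i : Fin j, Gv i • ContinuousLinearMap.proj (R := ℝ) (φ := fun _ : Fin (k + j) => ℝ) (Fin.natAdd k i)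

/-- Evaluation of the candidate derivative. [cite: Pawlucki2024, Lemma 5.4] -/
theorem vertexDeriv_apply (j : ℕ) (g' : (Fin k → ℝ) →L[ℝ] ℝ) (Gv : Fin j → ℝ) (v : Fin (k + j) → ℝ) :
    vertexDeriv k j g' Gv v = g' (upart j v) + ∑ i, Gv i * ypart j v i := by
  simp only [vertexDeriv, add_apply, ContinuousLinearMap.comp_apply, upartL_apply,
    FunLike.coe_sum, Finset.sum_apply, FunLike.coe_smul, Pi.smul_apply,
    ContinuousLinearMap.proj_apply, smul_eq_mul]
  rfl

/-- `upart` is additive. [cite: Pawlucki2024, Lemma 5.4] -/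
theorem upart_sub (j : ℕ) (z z' : Fin (k + j) → ℝ) : upart j (z - z') = upart j z - upart j z' := by
  funext i; simp [upart]

/-- `ypart` is additive. [cite: Pawlucki2024, Lemma 5.4] -/
theorem ypart_sub (j : ℕ) (z z' : Fin (k + j) → ℝ) : ypart j (z - z') = ypart j z - ypart j z' := by
  funext i; simp [ypart]

/-- **Differentiability of the extension at the vertex point** [Pawlucki2024, Lemma 5.4, last step
for `p = 1`]: if the `y`-partials of `f` tend to `G` at `(a, 0)` and the spine limit `g` is
differentiable at `a`, then the extension of `f` by `g` has derivative `(Dg(a), G)` at `(a, 0)`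
within the angle. [cite: Pawlucki2024, Lemma 5.4 (proof)] -/
theorem hasFDerivWithinAt_vertex {Ω : Set (Fin k → ℝ)} (hΩ : IsOpen Ω) {a : Fin k → ℝ} (ha : a ∈ Ω) (j : ℕ)
    (T : Tower k (j + 1)) (H : Tower.Hyp Ω (j + 1) T) {f : (Fin (k + (j + 1)) → ℝ) → ℝ} {Gv : Fin (j + 1) → ℝ}
    (hf : ∃ R : ℝ, 0 < R ∧ ∃ M : ℝ, 0 ≤ M ∧ GradHyp Ω (j + 1) T a R M f) (hD : DerivHyp Ω (j + 1) T a f Gv)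
    {g' : (Fin k → ℝ) →L[ℝ] ℝ} (hg : HasFDerivAt (spineLim (j + 1) T f) g' a) :
    HasFDerivWithinAt (angleExt (j + 1) f (spineLim (j + 1) T f)) (vertexDeriv k (j + 1) g' Gv)
      (angle Ω (j + 1) T) (spinePt (j + 1) a) := by
  classical
  set g := spineLim (j + 1) T f with hgdef
  set p := spinePt (j + 1) a with hp
  have hVD := vertex_deriv hΩ ha j T H f Gv hf hD
  rw [hasFDerivWithinAt_iff_isLittleO, Asymptotics.isLittleO_iff]
  intro ε hε
  obtain ⟨δ₁, hδ₁, h1⟩ := hVD (ε / 2) (half_pos hε)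
  have hg' := hg
  rw [hasFDerivAt_iff_isLittleO, Asymptotics.isLittleO_iff] at hg'
  have h2 := hg' (half_pos hε)
  obtain ⟨δ₂, hδ₂, h2⟩ := Metric.eventually_nhds_iff.1 h2
  have hball : ∀ᶠ z in 𝓝[angle Ω (j + 1) T] p, dist z p < min δ₁ δ₂ :=
    mem_nhdsWithin_of_mem_nhds (ball_mem_nhds p (lt_min hδ₁ hδ₂))
  filter_upwards [hball, self_mem_nhdsWithin] with z hzd hz
  have hFp : angleExt (j + 1) f g p = g a := by
    simp only [angleExt, hp, ypart_spinePt, upart_spinePt, if_true]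
  have hLzp : vertexDeriv k (j + 1) g' Gv (z - p) = g' (upart (j + 1) z - a) + ∑ i, Gv i * ypart (j + 1) z i := by
    rw [vertexDeriv_apply, upart_sub, ypart_sub, hp, upart_spinePt, ypart_spinePt]
    simp
  have hnorm : ‖z - p‖ = max (dist (upart (j + 1) z) a) ‖ypart (j + 1) z‖ := by rw [← dist_eq_norm, hp, dist_spinePt_eq]
  have hu : dist (upart (j + 1) z) a < δ₂ := by
    have h := hzd; rw [hp, dist_spinePt_eq] at h; exact (le_max_left _ _).trans_lt (h.trans_le (min_le_right _ _))
  have h2z := h2 hu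
  rw [← dist_eq_norm] at h2z
  rw [hFp, hLzp]
  by_cases hy : ypart (j + 1) z = 0
  · -- a spine point
    have hFz : angleExt (j + 1) f g z = g (upart (j + 1) z) := by simp only [angleExt, hy, if_true]
    rw [hFz, hy]
    simp only [Pi.zero_apply, mul_zero, Finset.sum_const_zero, add_zero]
    calc ‖g (upart (j + 1) z) - g a - g' (upart (j + 1) z - a)‖ ≤ ε / 2 * dist (upart (j + 1) z) a := h2z
      _ ≤ ε * ‖z - p‖ := by
          rw [hnorm]
          have := le_max_left (dist (upart (j + 1) z) a) ‖ypart (j + 1) z‖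
          nlinarith [dist_nonneg (x := upart (j + 1) z) (y := a)]
  · have hFz : angleExt (j + 1) f g z = f z := by simp only [angleExt, hy, if_false]
    rw [hFz]
    have h1z := h1 z hz (hzd.trans_le (min_le_left _ _)) hy
    have hsplit : f z - g a - (g' (upart (j + 1) z - a) + ∑ i, Gv i * ypart (j + 1) z i) =
        (f z - g (upart (j + 1) z) - ∑ i, Gv i * ypart (j + 1) z i) + (g (upart (j + 1) z) - g a - g' (upart (j + 1) z - a)) := by ring
    rw [hsplit]
    calc ‖(f z - g (upart (j + 1) z) - ∑ i, Gv i * ypart (j + 1) z i) + (g (upart (j + 1) z) - g a - g' (upart (j + 1) z - a))‖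
        ≤ ‖f z - g (upart (j + 1) z) - ∑ i, Gv i * ypart (j + 1) z i‖ + ‖g (upart (j + 1) z) - g a - g' (upart (j + 1) z - a)‖ := norm_add_le _ _
      _ ≤ ε / 2 * ‖ypart (j + 1) z‖ + ε / 2 * dist (upart (j + 1) z) a := by
          refine add_le_add ?_ h2z
          rw [Real.norm_eq_abs]; exact h1z
      _ ≤ ε * ‖z - p‖ := by
          rw [hnorm]
          have hm1 := le_max_left (dist (upart (j + 1) z) a) ‖ypart (j + 1) z‖
          have hm2 := le_max_right (dist (upart (j + 1) z) a) ‖ypart (j + 1) z‖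
          nlinarith [hε.le]

end AngleDeriv

end Literature.ModelTheory.ExponentialFields
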